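import Literature.AnabelianGeometry.EtaleTheta.Discharge.Sec2GaloisDictionaryOfSetting

/-!
# [EtTh] Def. 2.13 (i) at the §1/§2 model: the openness input `hopenY` reduced to ONE `D`-indexed hypothesis «`Π^tp_X → G_K` is open» (p. 273 / PDF p. 47)

Mochizuki, *The étale theta function …*, Publ. RIMS **45** (2009), Def. 2.13 (i) p.273 (PDF p.47); [SemiAnbd]
Ex. 3.10 p.43 ("natural exact sequence `1 → π₁^temp(X_K̄) → π₁^temp(X_K) → G_K → 1`")
[cite: MochizukiEtTh2009, Def 2.13 (i) p.273 (PDF p.47)].  Layer L2 of the abc-iut cell, seat abc-iut-L2-t11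
(gen 3); GAP-LEDGER row G-L2t11-3, abc-iut-L2-lead (gen 3) ruling of 05:40:05Z, parts (a) and (c); PROOF-ONLY
(0 defs; nothing landed is edited).

(a) REDUCTION.  The binder `hopenY : IsOpenMap (C.thetaEnvData μ hC hS).augY` of
`Sec2GaloisDictionaryOfSetting.lean` ("`Π^tp_Y̲̲ ↠ G_K` is open", Krull topology on `G_K = D.GK ≤ Gal(ℚ̄_p/ℚ_p)`)
— under which abc-iut-L2-t2's `kummerOut` at the model is EXACTLY the set of Kummer classes of `K^×` (Def. 2.13
(i): "the image of `K^× ↠ (K^×)/(K^×)^N ⥲ H¹(G_K, μ_N) → H¹(Π^tp_Y, μ_N) → Out(Π^tp_Y[μ_N])`") — FOLLOWS from the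
single `D`-indexed statement «the augmentation `Π^tp_X → G_K` of the theta setting `D` is an open map»
(`thetaEnvData_isOpenMap_augY_of_isOpenMap_aug`): `Π^tp_Y̲̲ = Π^tp_Y ∩ Π^tp_X̲̲` is OPEN in `Π^tp_X` (`Π^tp_Y =
Ker(Π^tp_X ↠ Z)` with `Z` discrete — interface field `isOpen_ker_toZ` — and `Π^tp_X̲̲` open, `isOpen_Huu`; open,
though of infinite index), and the restriction of an open map to an open subgroup is open.  Hence every consumer
(this seat's `thetaEnvData_exists_kummer_of_shift_mem_contMulAut`, and through the dictionary
`BiratAutAction.hKumC_of_hilbert90` of `Sec5KummerGaloisDictionary.lean`) takes ONE `D`-indexed hypothesis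
(`thetaEnvData_exists_kummer_of_isOpenMap_aug`).
(b) (NOT here — REFUTED.)  The `D`-indexed hypothesis is NOT satisfiable at abc-iut-L2-t1's root model
`ThetaSetting.model p`: there `Π^tp_X := F₂ × G_{ℚ_p}` carries the DISCRETE topology, and the augmentation is not
open — kernel certificate `SettingModel.not_isOpenMap_model_aug` (`SettingModelAugNotOpen.lean`, this seat).  So
«aug open» is a genuine-models-only input (it holds for the tempered fundamental group of a curve, where `G_K`
carries the quotient topology), to be supplied at a model whose Galois factor is topologised profinitely.
(c) INTERFACE FORM for the v-next census (abc-iut-L3 twin): «`X.aug : X.PiTemp →ₜ* GQp p` is open onto `X.GK`»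
for `X : SemiGraphs.TemperedCurve p`, resp. «`TemperedArithmeticGroup.aug : Pi →ₜ* Field.absoluteGaloisGroup K`
is an open (quotient) map» — [SemiAnbd] Ex. 3.10's exact sequence read TOPOLOGICALLY.
HONEST FRAMING: kernel-checked implications about the typed §1/§2 model; the `D`-indexed openness is a hypothesis,
not a fact; nothing of [EtTh]/[SemiAnbd] is asserted unconditionally; typed ≠ proved; no side is taken on
anything downstream ([IUTchIII] Cor. 3.12).
-/

noncomputable section

namespace Literature.AnabelianGeometry.EtaleTheta

open Literature.AnabelianGeometry.SemiGraphs

namespace ThetaSetting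

namespace EtaleThetaData.DoubleUnderline

variable {p : ℕ} [Fact p.Prime] {D : ThetaSetting p} {E : D.EtaleThetaData} {l : ℕ}
  (C : E.DoubleUnderline l) {N : ℕ+} (μ : D.CyclotomeMod l N) (hC : D.Compat) (hS : D.Sec2Hyps)

/-- The inclusion `Π^tp_Y̲̲ ↪ Π^tp_X` (through `Π^tp_X̲̲`) is an open embedding: `Π^tp_Y̲̲` is open in `Π^tp_X̲̲`
(interface field `PiY_open` of `thetaEnvData`, from `isOpen_ker_toZ`) and `Π^tp_X̲̲` is open in `Π^tp_X`
(`isOpen_Huu`).  [cite: MochizukiEtTh2009, Def 2.13 (i) p.273 (PDF p.47)] -/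
theorem isOpenEmbedding_thetaEnvData_PiY_val :
    Topology.IsOpenEmbedding fun q : (C.thetaEnvData μ hC hS).PiY => ((q : C.Huu) : D.PiTemp) :=
  C.isOpen_Huu.isOpenEmbedding_subtypeVal.comp (C.thetaEnvData μ hC hS).PiY_open.isOpenEmbedding_subtypeVal

/-- **(a) `hopenY` FROM «`Π^tp_X → G_K` is open»**: if the `G_K`-valued augmentation of the theta setting `D` is an
open map (Krull topology on `G_K ≤ Gal(ℚ̄_p/ℚ_p)`), then so is `Π^tp_Y̲̲ ↠ G_K` of the model `thetaEnvData` — the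
binder `hopenY` of `Sec2GaloisDictionaryOfSetting.lean` (GAP-LEDGER G-L2t11-3).
[cite: MochizukiEtTh2009, Def 2.13 (i) p.273 (PDF p.47)] -/
theorem thetaEnvData_isOpenMap_augY_of_isOpenMap_aug
    (hopen : IsOpenMap fun x : D.PiTemp => (⟨D.aug x, D.aug_mem_GK x⟩ : D.GK)) :
    IsOpenMap (C.thetaEnvData μ hC hS).augY := by
  intro U hU
  have h1 : IsOpen ((fun q : (C.thetaEnvData μ hC hS).PiY => ((q : C.Huu) : D.PiTemp)) '' U) :=
    (C.isOpenEmbedding_thetaEnvData_PiY_val μ hC hS).isOpenMap U hU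
  have h2 : (C.thetaEnvData μ hC hS).augY '' U =
      (fun x : D.PiTemp => (⟨D.aug x, D.aug_mem_GK x⟩ : D.GK)) ''
        ((fun q : (C.thetaEnvData μ hC hS).PiY => ((q : C.Huu) : D.PiTemp)) '' U) := by
    rw [Set.image_image]
    rfl
  rw [h2]
  exact hopen _ h1

/-- **Def. 2.13 (i), `kummerOut ⊆ Im(K^×)`, with the ONE `D`-indexed hypothesis**: if `Π^tp_X → G_K` is open, every
element of abc-iut-L2-t2's `kummerOut` at the model is the Kummer cocycle `σ ↦ σ(x)/x` of an `N`-th root `x` of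
some `a ∈ K^×` (this seat's `thetaEnvData_exists_kummer_of_shift_mem_contMulAut` with `hopenY` discharged by (a);
the converse inclusion `thetaEnvData_kummer_mem_kummerOut` is unconditional).
[cite: MochizukiEtTh2009, Def 2.13 (i) p.273 (PDF p.47)] -/
theorem thetaEnvData_exists_kummer_of_isOpenMap_aug
    (hopen : IsOpenMap fun x : D.PiTemp => (⟨D.aug x, D.aug_mem_GK x⟩ : D.GK)) (δ₀ : D.GK → MuN p N)
    (hδ : CycEnvelope.IsEnvCocycle (C.thetaEnvData μ hC hS).augY (C.thetaEnvData μ hC hS).chi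
      (δ₀ ∘ (C.thetaEnvData μ hC hS).augY))
    (hc : CycEnvelope.shift hδ ∈ contMulAut (C.thetaEnvData μ hC hS).env) :
    ∃ (a : (D.K)ˣ) (x : (PadicAlgCl p)ˣ),
      x ^ (N : ℕ) = Units.map (algebraMap D.K (PadicAlgCl p) : D.K →* PadicAlgCl p) a ∧
        ∀ g : D.GK, ((δ₀ g : MuN p N) : (PadicAlgCl p)ˣ) = (g : GQp p) • x / x :=
  C.thetaEnvData_exists_kummer_of_shift_mem_contMulAut μ hC hS
    (C.thetaEnvData_isOpenMap_augY_of_isOpenMap_aug μ hC hS hopen) δ₀ hδ hc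

/-- The `D`-indexed hypothesis in the plain form «`D.aug : Π^tp_X → Gal(ℚ̄_p/ℚ_p)` is an open map» also suffices
(its `G_K`-valued corestriction is then open: `G_K` is a subspace containing the image) — (c) the shape proposed for
the interface clause «`X.aug` open onto `X.GK`» at the v-next window.  [cite: MochizukiEtTh2009, Def 2.13 (i) p.273 (PDF p.47)] -/
theorem thetaEnvData_isOpenMap_augY_of_isOpenMap_aug' (hopen : IsOpenMap D.aug) :
    IsOpenMap (C.thetaEnvData μ hC hS).augY := by
  refine C.thetaEnvData_isOpenMap_augY_of_isOpenMap_aug μ hC hS ?_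
  intro U hU
  have h := hopen U hU
  rw [isOpen_induced_iff]
  refine ⟨D.aug '' U, h, ?_⟩
  ext g
  constructor
  · rintro ⟨x, hx, hxg⟩
    exact ⟨x, hx, Subtype.ext hxg⟩
  · rintro ⟨x, hx, hxg⟩
    exact ⟨x, hx, congrArg Subtype.val hxg⟩

end EtaleThetaData.DoubleUnderline

end ThetaSetting

end Literature.AnabelianGeometry.EtaleTheta

end
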